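import Literature.MathematicalPhysics.QuantumFieldTheory.Balaban1983to89.T3LevelShift
import Literature.MathematicalPhysics.QuantumFieldTheory.Balaban1983to89.B5Eq118OneStroke
import Literature.MathematicalPhysics.QuantumFieldTheory.Balaban1983to89.B3TorusRadialSums
import HarnessLib

/-!
# Crux `FluctuationComparisonRegPrIntL` (stmt-QuantumFields-20520, rung R3), PATH-B organ, discharge lane of the frozen rows `SpreadFibreLawH` ∕ `SpreadFibreLawHJ` ∕
# `OrganDischargeInputsHJ`: THE CHART BLOCK's CONJUNCTS [10]–[11] OUTRIGHT — THE STANDARD BLOCK PROJECTION `π : T^{(Ts)}_0 → T^{(j)}_0` IS `ℓ¹`-NON-EXPANDING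
# AND HAS FIBRES OF CARDINALITY `(L^{Ts−j})³`

Cell `ym3-torus` (YM ladder rung R3 = continuum `SU(2)` Yang–Mills on the three-torus — a RUNG: NOT d = 4, NOT infinite volume, NOT a mass gap, NOT Clay).
Width seat `ym-ust-20520-w4` (gen 24), `--kind proof --supports stmt-QuantumFields-20520 --as helper`, count-neutral, DEFINITION-FREE, default heartbeats,
`autoImplicit false`; registry (`Lines/semiclassical_s2beta.lean`, ★★OWNER RULING №36) and `Lines/` untouched.

WHAT.  The chart block [0]–[11] of the frozen hypothesis rows ✓`…RunpairOrganFibreLawDefs.SpreadFibreLawH` (v0.3m) ∕ ✓`…RunpairOrganFibreLawJDefs.SpreadFibreLawHJ`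
(v0.2) ∕ `Cruxes/…/DischargeInputsHJ.lean` ends with two conjuncts on a block projection `π : Site (F.P Ts) 0 → Site (F.P j) 0` that depend on NO chart and NO
analysis (LEAD-20520 `DISCHARGE-SPEC-SpreadFibreLawHJ-w3g26.md` v1.3 §D6 «the discharger supplies any block projection (the standard one) at zero cost»):
  [10] `∀ x y : Site (F.P Ts) 0, (((π x).tdist (π y) : ℕ) : ℝ) ≤ ((x.tdist y : ℕ) : ℝ)`  (distance non-expanding),
  [11] `∀ y : Site (F.P j) 0, ∃ s : Finset (Site (F.P Ts) 0), (∀ x, π x = y → x ∈ s) ∧ (s.card : ℝ) ≤ ((F.L : ℝ) ^ (Ts - j)) ^ 3`  (fibres).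
This file PAYS them, for every `F : T3Family` and `j ≤ Ts`, with THE STANDARD block projection
  `π := siteShift ⋯ ∘ iterBlockOf (Ts − j)`  (labels integer-divided by `L^{Ts−j}` coordinatewise — lit ✓`B5Eq118OneStroke.val_iterBlockOf` — then the level
  identification `Site (F.P Ts) (Ts − j) ≃ Site (F.P j) 0` of lit ✓`T3LevelShift.siteShift` along `2·L^{m+Ts−(Ts−j)} = 2·L^{m+j}`):
* §1 ONE COORDINATE: `val_sub_eq_ite` (the representative of a difference in `ZMod k`, by cases) and ★`val_sub_le_of_val_div` — for `n′ = n·M` and labels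
  `A.val = a.val ∕ M`, `B.val = b.val ∕ M`: `(A − B).val ≤ (a − b).val` (Euclidean division; the two wrap-around cases) — hence `cdist_sub_le_of_val_div`
  (the circular distance `cdist` of lit ✓`B3TorusRadialSums` can only shrink under the block map; sharper than ✓`…Prop7BlockDistanceWeights.tdist_iterBlockOf_le`'s
  `≤ |x−x′|₁ ∕ L^k + d`, which is what a CONTRACTION clause without additive slack needs);
* §2 `tdist_iterBlockOf_le_tdist` — `|B^k x − B^k y|₁ ≤ |x − y|₁` on `Site P 0` (`k ≤ m + K`); `tdist_siteShift` — the level identification is an `ℓ¹`-isometry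
  (the modulus identity `|T^{(0)}| = |T^{(k)}|·L^k` is a `private` copy of lit ✓`BIJ85Ineq722Torus.sitesPerDir_zero_eq`);
* §3 ★★ `exists_blockProjection` — conjuncts [10] ∧ [11] VERBATIM (the rows' text, `F j Ts` free, `j ≤ Ts`), zero hypotheses; fibre = lit ✓`card_iterBlock`
  (`|B^k(y)| = (L^d)^k`, `d = 3`) read through `siteShift`.
So a discharger of any of the three rows `obtain`s `π` and these two conjuncts from `exists_blockProjection F j Ts hjTs` and never thinks about them again.

HONEST FRAMING: finite-torus arithmetic [folklore]; NO chart, NO measure, NO gauge field; conjuncts [10]–[11] are IDLE for both knits (consumed by neither LIN nor Jensen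
knit) and paying them discharges NOTHING ELSE of `SpreadFibreLawH(J)` ∕ `OrganDischargeInputsHJ` (the chart [0]–[9], (H), (HV′), (I-geo)∕(I-curv)∕(I-law)∕(I-cov) stay
UNDISCHARGED hypothesis text); nothing of Bałaban's analysis is asserted or proved; O1ᵘ-H v2.2, S1aᴴ, S3ᴴ, S2α′, S2β, the five registered stubs OPEN; crux 20520
`FluctuationComparisonRegPrIntL` ∕ `YM3TorusSU2` NOT proved; rung R3 = SU(2) YM₃ on T³ at fixed lattice data — NOT d = 4, NOT infinite volume, NOT a mass gap, NOT Clay;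
the Yang–Mills mass gap is NOT proved.
-/

set_option autoImplicit false

namespace Summit.QuantumFields.YangMills.Theorems.OrganTangentBlockProjection

open Literature.MathematicalPhysics.QuantumFieldTheory.Balaban1983to89
open Literature.MathematicalPhysics.QuantumFieldTheory.Balaban1983to89.T3ContinuumYM3Torus
open Literature.MathematicalPhysics.QuantumFieldTheory.Balaban1983to89.T3LevelShift
open Literature.MathematicalPhysics.QuantumFieldTheory.Balaban1983to89.B5Eq118OneStroke (iterBlockOf iterBlock card_iterBlock mem_iterBlock val_iterBlockOf)
open Literature.MathematicalPhysics.QuantumFieldTheory.Balaban1983to89.B3TorusRadialSums (cdist tdist_eq_sum_cdist)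
open scoped BigOperators

/-! ## §1 One coordinate: the block map can only shrink the circular distance -/

/-- The canonical representative of a difference in `ZMod k`, by cases on the representatives. [folklore] -/
theorem val_sub_eq_ite {k : ℕ} [NeZero k] (x y : ZMod k) :
    (x - y).val = if y.val ≤ x.val then x.val - y.val else k - (y.val - x.val) := by
  split_ifs with h
  · exact ZMod.val_sub h
  · have hlt : x.val < y.val := lt_of_not_ge h
    have hyx : (y - x).val = y.val - x.val := ZMod.val_sub hlt.le
    have hne : y - x ≠ 0 := by
      intro h0
      have : (y - x).val = 0 := by rw [h0, ZMod.val_zero]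
      omega
    rw [← neg_sub, ZMod.neg_val, if_neg hne, hyx]

/-- ★ **ONE COORDINATE OF THE BLOCK MAP's CONTRACTION**: moduli `n′ = n·M` (`0 < M`), fine residues `a b : ZMod n′`, coarse residues `A B : ZMod n` with the
BLOCK labels `A.val = a.val ∕ M`, `B.val = b.val ∕ M`; then `(A − B).val ≤ (a − b).val` (both wrap-around cases by Euclidean division). [folklore] -/
theorem val_sub_le_of_val_div {n n' M : ℕ} [NeZero n] [NeZero n'] (hn : n' = n * M) (hM : 0 < M)
    (a b : ZMod n') (A B : ZMod n) (hAv : A.val = a.val / M) (hBv : B.val = b.val / M) :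
    (A - B).val ≤ (a - b).val := by
  subst hn
  have ha : a.val < n * M := ZMod.val_lt a
  have hb : b.val < n * M := ZMod.val_lt b
  have hp : a.val / M < n := Nat.div_lt_of_lt_mul (lt_of_lt_of_eq ha (Nat.mul_comm n M))
  have hq : b.val / M < n := Nat.div_lt_of_lt_mul (lt_of_lt_of_eq hb (Nat.mul_comm n M))
  rw [val_sub_eq_ite, val_sub_eq_ite, hAv, hBv]
  -- Euclidean divisions `a.val = M·p + r`, `b.val = M·q + s`
  set a₀ := a.val
  set b₀ := b.val
  have hae : M * (a₀ / M) + a₀ % M = a₀ := Nat.div_add_mod a₀ M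
  have hbe : M * (b₀ / M) + b₀ % M = b₀ := Nat.div_add_mod b₀ M
  have hsb : b₀ % M < M := Nat.mod_lt b₀ hM
  set p := a₀ / M
  set q := b₀ / M
  set r := a₀ % M
  set s := b₀ % M
  have hM1 : 1 ≤ M := hM
  by_cases hba : b₀ ≤ a₀
  · rw [if_pos hba]
    have hqp : q ≤ p := Nat.div_le_div_right hba
    rw [if_pos hqp]
    by_cases hpq : p = q
    · omega
    · have h1 : q + 1 ≤ p := by omega
      zify [hba, hqp, hM1] at hae hbe h1 ⊢
      have hs' : (s : ℤ) ≤ (M : ℤ) - 1 := by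
        have := hsb; zify [hM1] at this; linarith
      nlinarith [mul_nonneg (sub_nonneg.2 (show ((1 : ℕ) : ℤ) ≤ (M : ℤ) by exact_mod_cast hM1))
        (sub_nonneg.2 (show ((q : ℤ) + 1) ≤ (p : ℤ) by exact_mod_cast h1)), (Nat.cast_nonneg r : (0 : ℤ) ≤ r)]
  · rw [if_neg hba]
    have hab : a₀ < b₀ := lt_of_not_ge hba
    have hpq : p ≤ q := Nat.div_le_div_right hab.le
    by_cases hqp : q ≤ p
    · rw [if_pos hqp]
      have : p = q := le_antisymm hpq hqp
      omega
    · rw [if_neg hqp]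
      have hqpn : q - p ≤ n := by omega
      have hban : b₀ - a₀ ≤ n * M := by omega
      have h4 : q - p + 1 ≤ n := by omega
      zify [hqpn, hban, hab.le, hpq, hM1] at hae hbe h4 ⊢
      have hs' : (s : ℤ) ≤ (M : ℤ) - 1 := by
        have := hsb; zify [hM1] at this; linarith
      nlinarith [mul_nonneg (sub_nonneg.2 (show ((1 : ℕ) : ℤ) ≤ (M : ℤ) by exact_mod_cast hM1))
        (sub_nonneg.2 (show ((q : ℤ) - p + 1) ≤ (n : ℤ) by linarith)), (Nat.cast_nonneg r : (0 : ℤ) ≤ r),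
        (Nat.cast_nonneg s : (0 : ℤ) ≤ s)]

/-- **THE CIRCULAR DISTANCE SHRINKS UNDER THE BLOCK MAP** (one coordinate): with the data of `val_sub_le_of_val_div`, `cdist (A − B) ≤ cdist (a − b)`
(`cdist t = min t.val (−t).val`, lit ✓`B3TorusRadialSums.cdist`; the lemma applied in both orders). [folklore] -/
theorem cdist_sub_le_of_val_div {n n' M : ℕ} [NeZero n] [NeZero n'] (hn : n' = n * M) (hM : 0 < M)
    (a b : ZMod n') (A B : ZMod n) (hAv : A.val = a.val / M) (hBv : B.val = b.val / M) :
    cdist (A - B) ≤ cdist (a - b) := by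
  dsimp only [cdist]
  rw [neg_sub, neg_sub]
  exact min_le_min (val_sub_le_of_val_div hn hM a b A B hAv hBv) (val_sub_le_of_val_div hn hM b a B A hBv hAv)

/-! ## §2 The `k`-fold block map is `ℓ¹`-non-expanding; the level identification is an `ℓ¹`-isometry -/

/-- `|T^{(0)}| = |T^{(k)}|·L^k` per direction (standing range `k ≤ m + K`; private copy of lit ✓`BIJ85Ineq722Torus.sitesPerDir_zero_eq` ∕
✓`…Prop7BlockDistanceWeights.sitesPerDir_zero_eq_mul_pow`, kept local to avoid widening the import cone). [cite: Balaban1987RG1, (0.1) p.251] -/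
private theorem sitesPerDir_zero_eq {P : Params} {k : ℕ} (hk : k ≤ P.m + P.K) : P.sitesPerDir 0 = P.sitesPerDir k * P.L ^ k := by
  unfold Params.sitesPerDir
  rw [Nat.sub_zero, mul_assoc, ← pow_add, Nat.sub_add_cancel hk]

/-- ★ **THE `k`-FOLD BLOCK MAP IS `ℓ¹`-NON-EXPANDING**: `|B^k x − B^k y|₁ ≤ |x − y|₁` for fine sites `x y : Site P 0` (`k ≤ m + K`; coordinatewise
`cdist_sub_le_of_val_div` at `M = L^k` with lit ✓`val_iterBlockOf`). [cite: Balaban1984PropagatorsI, (1.6) p.18] -/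
theorem tdist_iterBlockOf_le_tdist {P : Params} {k : ℕ} (hk : k ≤ P.m + P.K) (x y : Site P 0) :
    Site.tdist (iterBlockOf k x) (iterBlockOf k y) ≤ Site.tdist x y := by
  rw [tdist_eq_sum_cdist, tdist_eq_sum_cdist]
  refine Finset.sum_le_sum fun μ _ => ?_
  exact cdist_sub_le_of_val_div (sitesPerDir_zero_eq hk) (pow_pos P.L_pos k) (x μ) (y μ) _ _
    (val_iterBlockOf k hk x μ) (val_iterBlockOf k hk y μ)

/-- **THE LEVEL IDENTIFICATION IS AN `ℓ¹`-ISOMETRY**: `siteShift` (lit ✓`T3LevelShift.siteShift`, coordinatewise `ZMod.ringEquivCongr`) preserves `tdist`.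
[cite: Balaban1987RG1, (0.1) p.251] -/
theorem tdist_siteShift {F : T3Family} {m K j m' K' j' : ℕ} (h : (F.PP m K).sitesPerDir j = (F.PP m' K').sitesPerDir j')
    (x y : Site (F.PP m K) j) : Site.tdist (siteShift h x) (siteShift h y) = Site.tdist x y := by
  unfold Site.tdist
  refine Finset.sum_congr rfl fun μ _ => ?_
  rw [siteShift_apply, siteShift_apply, ← map_sub, ← map_sub, coordEquiv_val, coordEquiv_val]

/-! ## §3 Conjuncts [10]–[11] of the chart block, outright -/

/-- ★★ **THE STANDARD BLOCK PROJECTION PAYS CONJUNCTS [10]–[11] OF THE FROZEN ROWS' CHART BLOCK** (texts VERBATIM; `F j Ts` free, `j ≤ Ts`; zero hypotheses):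
`π := siteShift ⋯ ∘ iterBlockOf (Ts − j)` is `ℓ¹`-non-expanding and every fibre lies in a finset of cardinality `≤ (L^{Ts−j})³` (in fact `=`, lit ✓`card_iterBlock`).
[cite: Balaban1984PropagatorsI, (1.6) p.18, (1.18) p.20; Balaban1987RG1, (0.1) p.251] -/
theorem exists_blockProjection (F : T3Family) (j Ts : ℕ) (hjTs : j ≤ Ts) :
    ∃ π : Site (F.P Ts) 0 → Site (F.P j) 0,
      (∀ x y : Site (F.P Ts) 0, (((π x).tdist (π y) : ℕ) : ℝ) ≤ ((x.tdist y : ℕ) : ℝ)) ∧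
      (∀ y : Site (F.P j) 0, ∃ s : Finset (Site (F.P Ts) 0), (∀ x, π x = y → x ∈ s) ∧ (s.card : ℝ) ≤ ((F.L : ℝ) ^ (Ts - j)) ^ 3) := by
  classical
  have hh : (F.PP F.m Ts).sitesPerDir (Ts - j) = (F.PP F.m j).sitesPerDir 0 := F.sitesPerDir_eq (by omega)
  have hk : Ts - j ≤ (F.P Ts).m + (F.P Ts).K := by
    show Ts - j ≤ F.m + Ts
    omega
  refine ⟨fun x => siteShift hh (iterBlockOf (Ts - j) x), ?_, ?_⟩
  · intro x y
    exact_mod_cast (tdist_siteShift hh _ _).trans_le (tdist_iterBlockOf_le_tdist hk x y)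
  · intro y
    refine ⟨iterBlock (Ts - j) ((siteShift hh).symm y), ?_, ?_⟩
    · intro x hx
      subst hx
      rw [mem_iterBlock]
      exact ((siteShift hh).symm_apply_apply _).symm
    · rw [card_iterBlock (Ts - j) hk]
      show (((F.L ^ 3) ^ (Ts - j) : ℕ) : ℝ) ≤ ((F.L : ℝ) ^ (Ts - j)) ^ 3
      push_cast
      rw [← pow_mul, ← pow_mul, mul_comm]

end Summit.QuantumFields.YangMills.Theorems.OrganTangentBlockProjection
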